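import Literature.AlgebraicGeometry.ComplexMultiplication.SimpleCMAbelianVarietyIsogenyClassesGaloisOrbits
import HarnessLib

/-!
# Milne 1999 Prop. 2.3 at a finite Galois CM level `k`: simple complex abelian varieties of CM-type whose reflex
# field is contained in `k`, up to isogeny, are the `Γ`-orbits of CM-types on `k`

Layer `Literature/AlgebraicGeometry/ComplexMultiplication` (lane `lit-hodgefound`; DAG-B node B5-05, last sentence —
FILE 2 of the row; FILE 1 = `SimpleCMAbelianVarietyIsogenyClassesGaloisOrbits`, the case `k = ℚ^{cm}`).  Small
definitions with bodies (the extension `extendGalCMType k` / `extendOrbit k` of CM-types and of their orbits from `k` to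
`ℚ^{cm}`, Milne's reflex field `SimpleCMAbelianVariety.reflexField` of a simple CM abelian variety, the sub-carrier
`WithReflexFieldLE k` with its isogeny setoid, the level-`k` orbit map `psiOrbitLevel` / `psiOrbitLevelClass` and the
packaged `Equiv`); everything else is proved; no named fact.

THE PRINT.  J. S. Milne, *Lefschetz motives and the Tate conjecture*, Compositio Math. 117 (1999) 45–76 (held text
`paper:doi-10-1023-a-1000776613765`; printed page = PDF page + 44), §2 p. 55:

> (L14–L18) The reflex field `K` of `(E, φ)` is defined to be the fixed field of the stabilizer of `φ` in `Γ`.  Thus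
> `σ ∈ Γ` fixes `K` if and only if `φ(σ⁻¹ ∘ τ) = φ(τ)` for all `τ : E → ℚ^{al}`.  For any `τ : E ↪ C`, `ψ_τ` is the
> extension to `ℚ^{cm}` of a primitive CM-type on `K`.  The reflex field of a simple Abelian variety over `C` of CM-type
> is defined to be the reflex field of its associated CM-type.
> (L19–L25) PROPOSITION 2.3. Let `K` be a CM-subfield of `C`. There is a natural one-to-one correspondence between the
> set of isogeny classes of simple Abelian varieties over `C` of CM-type whose reflex field is contained in `K` and the
> set of `Γ`-orbits of CM-types on `K`.  Proof. When `K = ℚ^{cm}`, this is an immediate consequence of the preceding two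
> propositions. The remark following the definition of the reflex field of a CM-type allows one to extend it to an
> arbitrary CM-subfield of `C`.

## Model (tree carriers, by name)

* the level: `k : IntermediateField ℚ ℚ^{cm}` of finite degree, CM and GALOIS over `ℚ` (`[NumberField k] [IsCMField k]
  [IsGalois ℚ k]`) — the case in which `Hom(k, ℚ^{al}) = Gal(k/ℚ)` and «CM-types on `k`» with their `Γ`-action are the
  tree's finite-level carrier `GalCMType k` of `PrimitiveCMPairsClassification` §7 (`Ψ ⊆ Gal(k/ℚ)`, `σ ∈ Ψ ↔ ισ ∉ Ψ`,
  `Γ` acting through `Gal(k/ℚ)` by left translation), orbit set `MulAction.orbitRel.Quotient (k ≃ₐ[ℚ] k) (GalCMType k)`;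
  `-- TODO(general form):` `K ⊂ ℂ` a CM-subfield NOT Galois over `ℚ` (as printed; Milne, *Complex Multiplication*
  Ex. 1.35 «Rewrite this section for a `k` that is not necessarily Galois over `ℚ`») is not covered by that carrier.
* «the reflex field of `(E, φ)` … the fixed field of the stabilizer of `φ` in `Γ`» — the tree's
  `reflexField ℚ ℚ^{cm} Φ^{cm}` (`ReflexType.reflexField`, `IntermediateField.fixedField (stabilizer Φ^{cm})`) for the
  `ℚ^{cm}`-valued form `Φ^{cm} = cmValued Φ.1` of the type of a CM-typed model; «the reflex field of a simple Abelian
  variety … of its associated CM-type» — `SimpleCMAbelianVariety.reflexField A`, computed on ANY CM-typed model of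
  any `B ∼ A` (`reflexField_eq`; well defined because isogenous simple varieties have isomorphic pairs,
  `exists_ringEquiv_forall_mem_iff_of_isIsogenous`, and isomorphic pairs have equal stabilisers).
* «`ψ_τ` is the extension to `ℚ^{cm}` of a CM-type on `K`» — `NumberFields.extendType ℚ^{cm} k Ψ = {σ | σ|_k ∈ Ψ}`
  (`CMNumbersCMTypes`), packaged as `extendGalCMType k : GalCMType k → CMNumbers.GalCMType` and on orbits
  `extendOrbit k`.

## What is proved

* §1 `nonempty_galCMType` (every CM field Galois over `ℚ` carries CM-types — validation V-B34 (α));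
  `extendGalCMType k` (a CM-type on `ℚ^{cm}`, `NumberFields.isCMTypeOn_extendType`, with
  `ι|_k = conjGal`, `restrictNormalHom_cmNumbersConj_eq_conjGal`), `Γ`-equivariance `extendGalCMType_smul`, injectivity,
  right-`Gal(ℚ^{cm}/k)`-invariance `mul_mem_extendGalCMType_iff` and **descent** `exists_extendGalCMType_eq` (a CM-type on
  `ℚ^{cm}` right-invariant under `Gal(ℚ^{cm}/k)` is extended from `k`); on orbits: `extendOrbit k`,
  **`extendOrbit_injective`** and the image **`mk_mem_range_extendOrbit_iff`** (the orbit of `Θ` comes from level `k`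
  iff `Θ` is right-`Gal(ℚ^{cm}/k)`-invariant).
* §2 the reflex field on a Galois level `Ω` (here `Ω = ℚ^{cm}`): `stabilizer_eq_of_isIsoCMPair` /
  `reflexField_eq_of_isIsoCMPair` (isomorphic pairs), `isOpen_stabilizer` and the Galois correspondence
  **`fixingSubgroup_reflexField : Gal(Ω/E*) = Stab(Φ)`** (`InfiniteGalois.fixingSubgroup_fixedField`, the stabiliser of a
  type of a field of finite degree being open), `reflexField_le_normalClosure`, and **«`σ` fixes `K` iff
  `φ(σ⁻¹ ∘ τ) = φ(τ)`» ⟹ `reflexField_le_iff_forall_mul_mem_psiType_iff`**: `E* ≤ k′` iff `ψ_ρ` is right-invariant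
  under `Gal(Ω/k′)`.
* §3 **`SimpleCMAbelianVariety.reflexField`** (`existsUnique_reflexField`, `reflexField_eq`, isogeny invariance
  `reflexField_eq_of_isIsogenous`, `reflexField_le_normalClosure`: it lies in the Galois closure of the CM field of any
  model) and the junction **`psiOrbit_mem_range_extendOrbit_iff : A.psiOrbit ∈ range (extendOrbit k) ↔ A.reflexField ≤ k`**.
* §4 **PROPOSITION 2.3 at level `k`**: the sub-carrier `WithReflexFieldLE k` with its isogeny setoid, `psiOrbitLevel`
  (`extendOrbit_psiOrbitLevel`), `psiOrbitLevelClass`, `psiOrbitLevelClass_injective`, `psiOrbitLevelClass_surjective`,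
  **`milne1999_prop_2_3 : Function.Bijective (psiOrbitLevelClass k)`**, the packaged
  **`WithReflexFieldLE.isogenyClassesEquivGalOrbits k : Quotient (isogenySetoid k) ≃ orbitRel.Quotient (k ≃ₐ[ℚ] k) (GalCMType k)`**
  and its compatibility with FILE 1's `ℚ^{cm}`-level correspondence (`extendOrbit_isogenyClassesEquivGalOrbits`);
  anti-vacuity `WithReflexFieldLE.nonempty` / `nonempty_quotient` (both sides of the bijection are inhabited for every
  such `k`).

## References

* [Milne1999] J. S. Milne, *Lefschetz motives and the Tate conjecture*, Compositio Math. 117 (1999) 45–76, §2 p. 55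
  (reflex field; Prop. 2.3 and its proof).
* [MilneCM2006] J. S. Milne, *Complex Multiplication* (course notes; v0.10, 2020), Ch. I §1 Prop. 1.30, Cor. 1.31,
  Ex. 1.35 (pp. 18–19) — through `PrimitiveCMPairsClassification` / `CMNumbersCMTypes`.
* [Shimura1998] G. Shimura, *Abelian Varieties with Complex Multiplication and Modular Functions* (1998), §8.3 Prop. 28
  (`H*` and `K*`) — through `ReflexType`.
-/

noncomputable section

open CategoryTheory NumberField
open scoped Pointwise

namespace Literature.AlgebraicGeometry.ComplexMultiplication

open Literature.AlgebraicGeometry.Motives (CMType AbelianVariety)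
open Literature.AlgebraicGeometry.Motives.AbelianVariety
open Literature.AlgebraicGeometry.HodgeTheory (complexBetti)
open Literature.NumberTheory.ComplexMultiplication
open Literature.NumberTheory.ComplexMultiplication.CMNumbers
open Literature.NumberTheory.NumberFields (cmNumbers cmNumbersConj IsCMTypeOn extendType mem_extendType_iff
  isCMTypeOn_extendType isCMTypeOn_iff mul_mem_extendType_iff restrictNormalHom_eq_one_iff_forall_algebraMap)

/-! ## §1 From CM-types on a finite Galois CM level `k ⊆ ℚ^{cm}` to CM-types on `ℚ^{cm}` -/

section AnyLevel

variable (Ω : Type*) [Field Ω] [NumberField Ω] [IsCMField Ω] [IsGalois ℚ Ω]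

/-- **There are CM-types on every CM field `k` Galois over `ℚ`** (validation V-B34 (α) of the lane's tribunal: the
orbit sets of Prop. 1.30 / Prop. 2.3 are not empty): the `ψ`-type `ψ_{id}` of any complex CM type `Φ₀` of `k` read in
`Hom_ℚ(k, k)` through a complex embedding (`algValuedIn`, `mem_algValuedIn_iff_conjGal_smul_notMem`,
`mem_psiType_iff_conjGal_mul_notMem`; a CM field has a CM type, `CMTypeCount.nonempty_cmType_iff_isTotallyComplex`).
[cite: Milne1999, §2 p. 54 L10–L11 and L38–L40] -/
instance nonempty_galCMType : Nonempty (GalCMType Ω) := by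
  obtain ⟨Φ₀⟩ : Nonempty (CMType Ω) := CMTypeCount.nonempty_cmType_iff_isTotallyComplex.2 inferInstance
  obtain ⟨ι⟩ := (inferInstance : Nonempty (Ω →+* ℂ))
  exact ⟨⟨psiType (algValuedIn ι Φ₀.1) (AlgHom.id ℚ Ω),
    mem_psiType_iff_conjGal_mul_notMem (mem_algValuedIn_iff_conjGal_smul_notMem ι Φ₀) _⟩⟩

/-- … hence `Γ`-orbits of them. [cite: Milne1999, §2 Prop. 2.3 (p. 55)] -/
instance nonempty_orbitRelQuotient_galCMType :
    Nonempty (MulAction.orbitRel.Quotient (Ω ≃ₐ[ℚ] Ω) (GalCMType Ω)) :=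
  ⟨Quotient.mk _ (Classical.arbitrary (GalCMType Ω))⟩

end AnyLevel

section Level

variable (k : IntermediateField ℚ cmNumbers) [NumberField k] [IsCMField k] [IsGalois ℚ k]

/-- On a finite Galois CM level `k ⊆ ℚ^{cm}` the CM condition of a type `Ψ ⊆ Gal(k/ℚ)` (for `conjGal`, the tree's
`GalCMType k`) is the CM condition for the conjugation `ι|_k` induced from `ℚ^{cm}`
(`restrictNormalHom_cmNumbersConj_eq_conjGal`). [cite: Milne1999, §2 p. 54 L38–L40] -/
theorem mem_galCMType_iff_restrictNormalHom (Ψ : GalCMType k) (σ : k ≃ₐ[ℚ] k) :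
    σ ∈ Ψ.1 ↔ AlgEquiv.restrictNormalHom k cmNumbersConj * σ ∉ Ψ.1 := by
  rw [restrictNormalHom_cmNumbersConj_eq_conjGal k]
  exact Ψ.2 σ

/-- **The extension to `ℚ^{cm}` of a CM-type on `k`** («`ψ_τ` is the extension to `ℚ^{cm}` of a … CM-type on `K`»;
`σ ↦ Ψ(σ|_k)`, the tree's `NumberFields.extendType`, a CM-type on `ℚ^{cm}` by `isCMTypeOn_extendType`).
[cite: Milne1999, §2 p. 55 L15–L16] -/
def extendGalCMType (Ψ : GalCMType k) : CMNumbers.GalCMType :=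
  ⟨extendType cmNumbers k Ψ.1, isCMTypeOn_extendType k (mem_galCMType_iff_restrictNormalHom k Ψ)⟩

/-- Unfolding `extendGalCMType`. [cite: Milne1999, §2 p. 55 L15–L16] -/
@[simp] theorem coe_extendGalCMType (Ψ : GalCMType k) : (extendGalCMType k Ψ).1 = extendType cmNumbers k Ψ.1 :=
  rfl

/-- `σ ∈ ext(Ψ) ↔ σ|_k ∈ Ψ`. [cite: Milne1999, §2 p. 55 L15–L16] -/
theorem mem_extendGalCMType_iff (Ψ : GalCMType k) (σ : cmNumbers ≃ₐ[ℚ] cmNumbers) :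
    σ ∈ (extendGalCMType k Ψ).1 ↔ AlgEquiv.restrictNormalHom k σ ∈ Ψ.1 :=
  Iff.rfl

omit [NumberField k] [IsCMField k] in
/-- `Gal(ℚ^{cm}/k)` is the kernel of the restriction `Gal(ℚ^{cm}/ℚ) → Gal(k/ℚ)` (bare-type form of Mathlib's
`IntermediateField.restrictNormalHom_ker`, through `NumberFields.restrictNormalHom_eq_one_iff_forall_algebraMap`).
[cite: Milne1999, §2 p. 54 L39] -/
theorem mem_fixingSubgroup_iff_restrictNormalHom_eq_one (g : cmNumbers ≃ₐ[ℚ] cmNumbers) :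
    g ∈ k.fixingSubgroup ↔ AlgEquiv.restrictNormalHom k g = 1 := by
  rw [restrictNormalHom_eq_one_iff_forall_algebraMap, IntermediateField.mem_fixingSubgroup_iff]
  exact ⟨fun h x ↦ h x.1 x.2, fun h x hx ↦ h ⟨x, hx⟩⟩

omit [NumberField k] [IsCMField k] in
/-- **Extension is `Γ`-equivariant** (for `Γ` acting on the types on `k` through `Gal(k/ℚ)`):
`ext((τ|_k) Ψ) = τ · ext(Ψ)`. [cite: Milne1999, §2 p. 54 L41–L42] -/
theorem extendType_smul (Ψ : Set (k ≃ₐ[ℚ] k)) (τ : cmNumbers ≃ₐ[ℚ] cmNumbers) :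
    extendType cmNumbers k (AlgEquiv.restrictNormalHom k τ • Ψ) = τ • extendType cmNumbers k Ψ := by
  ext σ
  rw [mem_extendType_iff, Set.mem_smul_set_iff_inv_smul_mem, Set.mem_smul_set_iff_inv_smul_mem,
    mem_extendType_iff, smul_eq_mul, smul_eq_mul, map_mul, map_inv]

/-- [cite: Milne1999, §2 p. 54 L41–L42] -/
theorem extendGalCMType_smul (Ψ : GalCMType k) (τ : cmNumbers ≃ₐ[ℚ] cmNumbers) :
    extendGalCMType k (AlgEquiv.restrictNormalHom k τ • Ψ) = τ • extendGalCMType k Ψ :=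
  Subtype.ext (extendType_smul k Ψ.1 τ)

/-- Extension from `k` is injective (restriction `Gal(ℚ^{cm}/ℚ) → Gal(k/ℚ)` is surjective).
[cite: Milne1999, §2 p. 55 L15–L16] -/
theorem extendGalCMType_injective : Function.Injective (extendGalCMType k) := fun _ _ h ↦
  Subtype.ext ((AlgEquiv.restrictNormalHom_surjective (K₁ := k) cmNumbers).preimage_injective
    (congrArg Subtype.val h))

/-- An extended type is right-invariant under `Gal(ℚ^{cm}/k)` («`ψ_τ` depends only on the restriction of `σ`»).
[cite: Milne1999, §2 p. 54 L39] -/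
theorem mul_mem_extendGalCMType_iff (Ψ : GalCMType k) {g : cmNumbers ≃ₐ[ℚ] cmNumbers}
    (hg : g ∈ k.fixingSubgroup) (σ : cmNumbers ≃ₐ[ℚ] cmNumbers) :
    σ * g ∈ (extendGalCMType k Ψ).1 ↔ σ ∈ (extendGalCMType k Ψ).1 :=
  mul_mem_extendType_iff k Ψ.1 ((mem_fixingSubgroup_iff_restrictNormalHom_eq_one k g).mp hg) σ

/-- **Descent**: a CM-type on `ℚ^{cm}` which is right-invariant under `Gal(ℚ^{cm}/k)` is the extension of a CM-type on
`k` (namely of its image in `Gal(k/ℚ)`). [cite: Milne1999, §2 p. 55 L15–L16 and L22–L25] -/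
theorem exists_extendGalCMType_eq {Θ : CMNumbers.GalCMType}
    (hΘ : ∀ g ∈ k.fixingSubgroup, ∀ σ, σ * g ∈ Θ.1 ↔ σ ∈ Θ.1) : ∃ Ψ : GalCMType k, extendGalCMType k Ψ = Θ := by
  -- membership in `Θ` only depends on the restriction to `k`
  have key : ∀ σ : cmNumbers ≃ₐ[ℚ] cmNumbers,
      AlgEquiv.restrictNormalHom k σ ∈ AlgEquiv.restrictNormalHom k '' Θ.1 ↔ σ ∈ Θ.1 := by
    intro σ
    constructor
    · rintro ⟨σ', hσ', h⟩
      have hg : σ'⁻¹ * σ ∈ k.fixingSubgroup := by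
        rw [mem_fixingSubgroup_iff_restrictNormalHom_eq_one, map_mul, map_inv, h, inv_mul_cancel]
      have h' := (hΘ _ hg σ').mpr hσ'
      rwa [mul_inv_cancel_left] at h'
    · exact fun h ↦ ⟨σ, h, rfl⟩
  have hcm : ∀ σ : cmNumbers ≃ₐ[ℚ] cmNumbers, σ ∈ Θ.1 ↔ cmNumbersConj * σ ∉ Θ.1 :=
    ((isCMTypeOn_iff _).mp Θ.2).2
  refine ⟨⟨AlgEquiv.restrictNormalHom k '' Θ.1, fun σk ↦ ?_⟩, Subtype.ext (Set.ext fun σ ↦ key σ)⟩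
  obtain ⟨σ, rfl⟩ := AlgEquiv.restrictNormalHom_surjective (K₁ := k) cmNumbers σk
  rw [← restrictNormalHom_cmNumbersConj_eq_conjGal k, ← map_mul, key, key]
  exact hcm σ

/-- **Extension on orbits**: `Gal(k/ℚ) • Ψ ↦ Gal(ℚ^{cm}/ℚ) • ext(Ψ)` (well defined by equivariance and the
surjectivity of restriction). [cite: Milne1999, §2 Prop. 2.3 proof (p. 55)] -/
def extendOrbit : MulAction.orbitRel.Quotient (k ≃ₐ[ℚ] k) (GalCMType k) →
    MulAction.orbitRel.Quotient (cmNumbers ≃ₐ[ℚ] cmNumbers) CMNumbers.GalCMType :=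
  Quotient.map (extendGalCMType k) fun _ _ h ↦ by
    obtain ⟨τk, hτ⟩ := MulAction.orbitRel_apply.mp h
    obtain ⟨τ, rfl⟩ := AlgEquiv.restrictNormalHom_surjective (K₁ := k) cmNumbers τk
    refine MulAction.orbitRel_apply.mpr ⟨τ, ?_⟩
    have h' := congrArg (extendGalCMType k) hτ
    rwa [extendGalCMType_smul] at h'

/-- `extendOrbit k [Ψ] = [ext Ψ]`. [cite: Milne1999, §2 Prop. 2.3 proof (p. 55)] -/
@[simp] theorem extendOrbit_mk (Ψ : GalCMType k) :
    extendOrbit k (Quotient.mk _ Ψ) =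
      Quotient.mk (MulAction.orbitRel (cmNumbers ≃ₐ[ℚ] cmNumbers) CMNumbers.GalCMType) (extendGalCMType k Ψ) :=
  rfl

/-- **`extendOrbit k` is injective**: `Γ`-orbits of CM-types on `k` embed into `Γ`-orbits of CM-types on `ℚ^{cm}`.
[cite: Milne1999, §2 Prop. 2.3 proof (p. 55)] -/
theorem extendOrbit_injective : Function.Injective (extendOrbit k) := by
  intro a b
  induction a using Quotient.inductionOn with | h Ψ => ?_
  induction b using Quotient.inductionOn with | h Ψ' => ?_
  intro h
  rw [extendOrbit_mk, extendOrbit_mk] at h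
  obtain ⟨τ, hτ⟩ := MulAction.orbitRel_apply.mp (Quotient.exact h)
  have hτ' : extendGalCMType k (AlgEquiv.restrictNormalHom k τ • Ψ') = extendGalCMType k Ψ := by
    rw [extendGalCMType_smul]
    exact hτ
  exact Quotient.sound (MulAction.orbitRel_apply.mpr ⟨AlgEquiv.restrictNormalHom k τ, extendGalCMType_injective k hτ'⟩)

/-- **The image of `extendOrbit k`**: the orbit of a CM-type `Θ` on `ℚ^{cm}` comes from level `k` iff `Θ` is
right-invariant under `Gal(ℚ^{cm}/k)` (i.e. `Θ(σ)` depends only on `σ|_k`; the condition does not depend on the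
representative, `Gal(ℚ^{cm}/k)` being normal in `Gal(ℚ^{cm}/ℚ)`). [cite: Milne1999, §2 p. 55 L15–L16 and Prop. 2.3 proof] -/
theorem mk_mem_range_extendOrbit_iff (Θ : CMNumbers.GalCMType) :
    Quotient.mk (MulAction.orbitRel (cmNumbers ≃ₐ[ℚ] cmNumbers) CMNumbers.GalCMType) Θ ∈ Set.range (extendOrbit k) ↔
      ∀ g ∈ k.fixingSubgroup, ∀ σ, σ * g ∈ Θ.1 ↔ σ ∈ Θ.1 := by
  constructor
  · rintro ⟨c, hc⟩
    induction c using Quotient.inductionOn with | h Ψ => ?_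
    rw [extendOrbit_mk] at hc
    obtain ⟨τ, hτ⟩ := MulAction.orbitRel_apply.mp (Quotient.exact hc)
    -- `Θ = τ⁻¹ • ext Ψ = ext(τ⁻¹|_k • Ψ)`
    have hΘ : Θ = extendGalCMType k (AlgEquiv.restrictNormalHom k τ⁻¹ • Ψ) := by
      rw [extendGalCMType_smul, ← hτ, inv_smul_smul]
    intro g hg σ
    rw [hΘ]
    exact mul_mem_extendGalCMType_iff k _ hg σ
  · intro hΘ
    obtain ⟨Ψ, hΨ⟩ := exists_extendGalCMType_eq k hΘ
    exact ⟨Quotient.mk _ Ψ, by rw [extendOrbit_mk, hΨ]⟩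

end Level

/-! ## §2 The reflex field on a Galois level (Milne 1999: the fixed field of the stabiliser of the type in `Γ`) -/

section ReflexGeneric

variable {Ω : Type*} [Field Ω] [CharZero Ω] {K : Type*} [Field K] [Algebra ℚ K] {K' : Type*} [Field K'] [Algebra ℚ K']

/-- **Isomorphic CM-pairs have the same stabiliser in `Γ`** (`φ′ ↦ φ′ ∘ α` is a `Γ`-equivariant bijection
`Hom(E′, k) → Hom(E, k)` carrying `Φ′` onto `Φ`). [cite: Milne1999, §2 p. 55 L14–L15] -/
theorem stabilizer_eq_of_isIsoCMPair {Φ : Set (K →ₐ[ℚ] Ω)} {Φ' : Set (K' →ₐ[ℚ] Ω)} (h : IsIsoCMPair Φ Φ') :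
    MulAction.stabilizer (Ω ≃ₐ[ℚ] Ω) Φ = MulAction.stabilizer (Ω ≃ₐ[ℚ] Ω) Φ' := by
  obtain ⟨α, hα⟩ := h
  let f : (K' →ₐ[ℚ] Ω) → (K →ₐ[ℚ] Ω) := fun φ' ↦ φ'.comp (α : K →ₐ[ℚ] K')
  have hf : ∀ (g : Ω ≃ₐ[ℚ] Ω) (φ' : K' →ₐ[ℚ] Ω), f (g • φ') = g • f φ' := fun _ _ ↦ rfl
  have hsurj : Function.Surjective f := fun φ ↦
    ⟨φ.comp (α.symm : K' →ₐ[ℚ] K), AlgHom.ext fun x ↦ by simp [f]⟩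
  have hΦ' : Φ' = f ⁻¹' Φ := Set.ext fun φ' ↦ hα φ'
  have hpre : ∀ g : Ω ≃ₐ[ℚ] Ω, g • (f ⁻¹' Φ) = f ⁻¹' (g • Φ) := fun g ↦ Set.ext fun φ' ↦ by
    rw [Set.mem_smul_set_iff_inv_smul_mem, Set.mem_preimage, Set.mem_preimage, Set.mem_smul_set_iff_inv_smul_mem, hf]
  ext g
  rw [MulAction.mem_stabilizer_iff, MulAction.mem_stabilizer_iff, hΦ', hpre]
  exact ⟨fun h ↦ by rw [h], fun h ↦ hsurj.preimage_injective h⟩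

/-- **Isomorphic CM-pairs have the same reflex field** (the fixed field of the stabiliser).
[cite: Milne1999, §2 p. 55 L14–L15] -/
theorem reflexField_eq_of_isIsoCMPair {Φ : Set (K →ₐ[ℚ] Ω)} {Φ' : Set (K' →ₐ[ℚ] Ω)} (h : IsIsoCMPair Φ Φ') :
    reflexField ℚ Ω Φ = reflexField ℚ Ω Φ' := by
  rw [reflexField_eq_fixedField, reflexField_eq_fixedField, stabilizer_eq_of_isIsoCMPair h]

/-- `Gal(k/N)`, `N` the normal closure of `E` in `k`, fixes every embedding `E → k`, hence stabilises every type
`Φ ⊆ Hom(E, k)`. [cite: Milne1999, §2 p. 54 L39 («depends only on the restriction»)] -/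
theorem fixingSubgroup_normalClosure_le_stabilizer (Φ : Set (K →ₐ[ℚ] Ω)) :
    (IntermediateField.normalClosure ℚ K Ω).fixingSubgroup ≤ MulAction.stabilizer (Ω ≃ₐ[ℚ] Ω) Φ := by
  intro τ hτ
  rw [MulAction.mem_stabilizer_iff]
  ext φ
  rw [Set.mem_smul_set_iff_inv_smul_mem, smul_eq_self_of_mem_fixingSubgroup_normalClosure φ (inv_mem hτ)]

/-- **The stabiliser of a type of a field of finite degree is open** in the Krull topology (it contains the open
subgroup `Gal(k/N)`). [cite: Milne1999, §2 p. 54 L10 («locally constant»)] -/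
theorem isOpen_stabilizer [FiniteDimensional ℚ K] (Φ : Set (K →ₐ[ℚ] Ω)) :
    IsOpen (MulAction.stabilizer (Ω ≃ₐ[ℚ] Ω) Φ : Set (Ω ≃ₐ[ℚ] Ω)) :=
  Subgroup.isOpen_mono (fixingSubgroup_normalClosure_le_stabilizer Φ)
    (IntermediateField.fixingSubgroup_isOpen _)

/-- **Galois correspondence for the reflex field on an infinite Galois level**: `Gal(k/E*) = Stab(Φ)` (the stabiliser
is open, hence closed; `InfiniteGalois.fixingSubgroup_fixedField`). [cite: Milne1999, §2 p. 55 L14–L15] -/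
theorem fixingSubgroup_reflexField [IsGalois ℚ Ω] [FiniteDimensional ℚ K] (Φ : Set (K →ₐ[ℚ] Ω)) :
    (reflexField ℚ Ω Φ).fixingSubgroup = MulAction.stabilizer (Ω ≃ₐ[ℚ] Ω) Φ :=
  InfiniteGalois.fixingSubgroup_fixedField
    ⟨MulAction.stabilizer (Ω ≃ₐ[ℚ] Ω) Φ, (MulAction.stabilizer (Ω ≃ₐ[ℚ] Ω) Φ).isClosed_of_isOpen (isOpen_stabilizer Φ)⟩

/-- **The reflex field lies in the normal closure** of `E` in the Galois level (`Gal(k/N) ≤ Stab(Φ)` and the Galois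
correspondence `InfiniteGalois.fixedField_fixingSubgroup`): every type is «defined» at the finite Galois level `N`.
[cite: Milne1999, §2 p. 55 L14–L16] -/
theorem reflexField_le_normalClosure [IsGalois ℚ Ω] (Φ : Set (K →ₐ[ℚ] Ω)) :
    reflexField ℚ Ω Φ ≤ IntermediateField.normalClosure ℚ K Ω :=
  (reflexField_le_fixedField ℚ Ω (fixingSubgroup_normalClosure_le_stabilizer Φ)).trans_eq
    (InfiniteGalois.fixedField_fixingSubgroup _)

/-- **«Thus `σ ∈ Γ` fixes `K` if and only if `φ(σ⁻¹ ∘ τ) = φ(τ)` for all `τ`» ⟹ `ψ_τ` is defined at level `k′` iff the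
reflex field is contained in `k′`**: for an intermediate field `k′` of the Galois level, `E* ≤ k′` iff `ψ_ρ = S*(Φ, ρ)`
is right-invariant under `Gal(k/k′)`. [cite: Milne1999, §2 p. 55 L14–L16] -/
theorem reflexField_le_iff_forall_mul_mem_psiType_iff [IsGalois ℚ Ω] [FiniteDimensional ℚ K] (Φ : Set (K →ₐ[ℚ] Ω))
    (ρ : K →ₐ[ℚ] Ω) (k' : IntermediateField ℚ Ω) :
    reflexField ℚ Ω Φ ≤ k' ↔ ∀ g ∈ k'.fixingSubgroup, ∀ σ, σ * g ∈ psiType Φ ρ ↔ σ ∈ psiType Φ ρ := by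
  rw [psiType_eq_reflexLift]
  constructor
  · intro hle g hg σ
    have hg' : g ∈ MulAction.stabilizer (Ω ≃ₐ[ℚ] Ω) Φ := by
      rw [← fixingSubgroup_reflexField Φ]
      exact IntermediateField.fixingSubgroup_le hle hg
    exact mul_mem_reflexLift_iff_of_mem_stabilizer Φ ρ hg' σ
  · exact reflexField_le_of_forall_mul_mem_iff ℚ Ω Φ ρ k'

end ReflexGeneric

/-! ## §3 The reflex field of a simple complex abelian variety of CM-type -/

namespace SimpleCMAbelianVariety

variable (A : SimpleCMAbelianVariety)

/-- The reflex field attached to `A` is well defined: all CM-typed models `(K; Φ)` of all `B ∼ A` have the same reflex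
field `reflexField ℚ ℚ^{cm} Φ^{cm}` (isogenous simple ⟹ isomorphic pairs ⟹ equal stabilisers).
[cite: Milne1999, §2 p. 55 L17–L18] -/
theorem existsUnique_reflexField :
    ∃! F : IntermediateField ℚ cmNumbers,
      ∀ {K : Type} [Field K] [NumberField K] [IsCMField K] (Φ : CMType K) (B : AbelianVariety ℂ)
        (ι : 𝓞 K →+* End B) (θ : K →+* Module.End ℂ (complexBetti B.X 1)),
        IsCMTypeRealisation Φ B ι θ → IsIsogenous A.1 B →
          Literature.NumberTheory.ComplexMultiplication.reflexField ℚ cmNumbers (cmValued Φ.1) = F := by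
  obtain ⟨K₀, _, _, _, Φ₀, B₀, ι₀, θ₀, hB₀, hAB₀⟩ := A.exists_isCMTypeRealisation_isIsogenous
  refine ⟨Literature.NumberTheory.ComplexMultiplication.reflexField ℚ cmNumbers (cmValued Φ₀.1),
    fun Φ B ι θ hB hAB ↦ ?_, fun F hF ↦ (hF Φ₀ B₀ ι₀ θ₀ hB₀ hAB₀).symm⟩
  obtain ⟨e, he⟩ := exists_ringEquiv_forall_mem_iff_of_isIsogenous hB hB₀ (A.isSimple.of_isIsogenous hAB)
    (hAB.symm'.trans hAB₀)
  exact reflexField_eq_of_isIsoCMPair ((isIsoCMPair_cmValued_iff Φ.1 Φ₀.1).mpr ⟨e, he⟩)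

/-- **The reflex field of a simple complex abelian variety of CM-type** («defined to be the reflex field of its
associated CM-type», the reflex field of `(E, φ)` being «the fixed field of the stabilizer of `φ` in `Γ`»): the subfield
`reflexField ℚ ℚ^{cm} Φ^{cm} ⊆ ℚ^{cm}` of any CM-typed model (`reflexField_eq`). [cite: Milne1999, §2 p. 55 L14–L18] -/
def reflexField : IntermediateField ℚ cmNumbers :=
  A.existsUnique_reflexField.exists.choose

variable {A}
variable {K : Type} [Field K] [NumberField K] [IsCMField K] {Φ : CMType K} {B : AbelianVariety ℂ}
  {ι : 𝓞 K →+* End B} {θ : K →+* Module.End ℂ (complexBetti B.X 1)}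

/-- **`reflexField` computed on any model.** [cite: Milne1999, §2 p. 55 L14–L18] -/
theorem reflexField_eq (hB : IsCMTypeRealisation Φ B ι θ) (hAB : IsIsogenous A.1 B) :
    A.reflexField = Literature.NumberTheory.ComplexMultiplication.reflexField ℚ cmNumbers (cmValued Φ.1) :=
  (A.existsUnique_reflexField.exists.choose_spec Φ B ι θ hB hAB).symm

/-- The reflex field is an isogeny invariant. [cite: Milne1999, §2 p. 55 L17–L18] -/
theorem reflexField_eq_of_isIsogenous {A A' : SimpleCMAbelianVariety} (h : IsIsogenous A.1 A'.1) :
    A.reflexField = A'.reflexField := by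
  obtain ⟨K, _, _, _, Φ, B, ι, θ, hB, hAB⟩ := A'.exists_isCMTypeRealisation_isIsogenous
  rw [reflexField_eq hB hAB, reflexField_eq hB (h.trans hAB)]

/-- **The reflex field of `A` lies in the Galois closure (in `ℚ^{cm}`) of the CM field of any CM-typed model** — so
every simple CM abelian variety is covered by Proposition 2.3 at some finite Galois CM level `k`.
[cite: Milne1999, §2 p. 55 L14–L18] -/
theorem reflexField_le_normalClosure (hB : IsCMTypeRealisation Φ B ι θ) (hAB : IsIsogenous A.1 B) :
    A.reflexField ≤ IntermediateField.normalClosure ℚ K cmNumbers := by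
  rw [reflexField_eq hB hAB]
  exact Literature.AlgebraicGeometry.ComplexMultiplication.reflexField_le_normalClosure (cmValued Φ.1)

/-! ## §4 Proposition 2.3 at a finite Galois CM level `k ⊆ ℚ^{cm}` -/

variable (k : IntermediateField ℚ cmNumbers) [NumberField k] [IsCMField k] [IsGalois ℚ k]

/-- **«whose reflex field is contained in `K`» ⟺ `{ψ_τ}` comes from level `K`**: the `Γ`-orbit of `A` is the extension
of a `Γ`-orbit of CM-types on `k` iff the reflex field of `A` is contained in `k` («The remark following the definition
of the reflex field of a CM-type allows one to extend it to an arbitrary CM-subfield»).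
[cite: Milne1999, §2 p. 55 L15–L16 and Prop. 2.3 proof (L22–L25)] -/
theorem psiOrbit_mem_range_extendOrbit_iff (A : SimpleCMAbelianVariety) :
    A.psiOrbit ∈ Set.range (extendOrbit k) ↔ A.reflexField ≤ k := by
  obtain ⟨K, _, _, _, Φ, B, ι, θ, hB, hAB⟩ := A.exists_isCMTypeRealisation_isIsogenous
  obtain ⟨φ₀⟩ := (inferInstance : Nonempty (K →+* ℂ))
  rw [psiOrbit_eq_mk hB hAB φ₀, mk_mem_range_extendOrbit_iff, reflexField_eq hB hAB,
    reflexField_le_iff_forall_mul_mem_psiType_iff (cmValued Φ.1) (toCMNumbers φ₀) k]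
  rfl

/-- **The simple abelian varieties over `ℂ` of CM-type whose reflex field is contained in `k`.**
[cite: Milne1999, §2 Prop. 2.3 (p. 55)] -/
def WithReflexFieldLE : Type 1 :=
  {A : SimpleCMAbelianVariety // A.reflexField ≤ k}

namespace WithReflexFieldLE

/-- Isogeny as a `Setoid` on the simple CM abelian varieties with reflex field in `k`.
[cite: Milne1999, §2 Prop. 2.3 (p. 55)] -/
instance isogenySetoid : Setoid (WithReflexFieldLE k) where
  r A A' := IsIsogenous A.1.1 A'.1.1
  iseqv := ⟨fun A ↦ IsIsogenous.refl A.1.1, fun h ↦ h.symm', fun h h' ↦ h.trans h'⟩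

variable {k} in
/-- **The level-`k` orbit of `A`**: the unique `Gal(k/ℚ)`-orbit of CM-types on `k` whose extension to `ℚ^{cm}` is
`{ψ_τ}(A)` (exists iff the reflex field is in `k`, unique by `extendOrbit_injective`). [cite: Milne1999, §2 Prop. 2.3 (p. 55)] -/
def psiOrbitLevel (A : WithReflexFieldLE k) : MulAction.orbitRel.Quotient (k ≃ₐ[ℚ] k) (GalCMType k) :=
  ((psiOrbit_mem_range_extendOrbit_iff k A.1).mpr A.2).choose

/-- `ext(psiOrbitLevel A) = psiOrbit A`. [cite: Milne1999, §2 Prop. 2.3 (p. 55)] -/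
theorem extendOrbit_psiOrbitLevel (A : WithReflexFieldLE k) : extendOrbit k (psiOrbitLevel A) = A.1.psiOrbit :=
  ((psiOrbit_mem_range_extendOrbit_iff k A.1).mpr A.2).choose_spec

variable {k} in
/-- [cite: Milne1999, §2 Prop. 2.3 (p. 55)] -/
theorem psiOrbitLevel_eq_of_isIsogenous {A A' : WithReflexFieldLE k} (h : IsIsogenous A.1.1 A'.1.1) :
    psiOrbitLevel A = psiOrbitLevel A' :=
  extendOrbit_injective k (by
    rw [extendOrbit_psiOrbitLevel, extendOrbit_psiOrbitLevel, psiOrbit_eq_of_isIsogenous h])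

/-- **The map of Proposition 2.3 at level `k`** on isogeny classes. [cite: Milne1999, §2 Prop. 2.3 (p. 55)] -/
def psiOrbitLevelClass :
    Quotient (isogenySetoid k) → MulAction.orbitRel.Quotient (k ≃ₐ[ℚ] k) (GalCMType k) :=
  Quotient.lift psiOrbitLevel fun _ _ h ↦ psiOrbitLevel_eq_of_isIsogenous h

/-- [cite: Milne1999, §2 Prop. 2.3 (p. 55)] -/
@[simp] theorem psiOrbitLevelClass_mk (A : WithReflexFieldLE k) :
    psiOrbitLevelClass k (Quotient.mk (isogenySetoid k) A) = psiOrbitLevel A :=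
  rfl

/-- **Injectivity at level `k`.** [cite: Milne1999, §2 Prop. 2.3 (p. 55)] -/
theorem psiOrbitLevelClass_injective : Function.Injective (psiOrbitLevelClass k) := by
  intro a b
  induction a using Quotient.inductionOn with | h A => ?_
  induction b using Quotient.inductionOn with | h A' => ?_
  intro h
  rw [psiOrbitLevelClass_mk, psiOrbitLevelClass_mk] at h
  have h' : A.1.psiOrbit = A'.1.psiOrbit := by
    rw [← extendOrbit_psiOrbitLevel k A, ← extendOrbit_psiOrbitLevel k A', h]
  exact Quotient.sound (isIsogenous_of_psiOrbit_eq h')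

/-- **Surjectivity at level `k`**: every `Gal(k/ℚ)`-orbit of CM-types on `k` is the level-`k` orbit of a simple complex
abelian variety of CM-type with reflex field in `k` (realise its extension to `ℚ^{cm}`). [cite: Milne1999, §2 Prop. 2.3 (p. 55)] -/
theorem psiOrbitLevelClass_surjective : Function.Surjective (psiOrbitLevelClass k) := by
  intro c
  obtain ⟨a, ha⟩ := psiOrbitClass_surjective (extendOrbit k c)
  induction a using Quotient.inductionOn with | h A => ?_
  rw [psiOrbitClass_mk] at ha
  have hA : A.reflexField ≤ k := (psiOrbit_mem_range_extendOrbit_iff k A).mp ⟨c, ha.symm⟩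
  refine ⟨Quotient.mk (isogenySetoid k) ⟨A, hA⟩, ?_⟩
  rw [psiOrbitLevelClass_mk]
  exact extendOrbit_injective k ((extendOrbit_psiOrbitLevel k ⟨A, hA⟩).trans ha)

/-- **PROPOSITION 2.3** (Milne 1999 §2) at a finite Galois CM level `k ⊆ ℚ^{cm}`: `[A] ↦` (the `Gal(k/ℚ)`-orbit of
CM-types on `k` extending to `{ψ_τ}(A)`) is a BIJECTION from the isogeny classes of simple abelian varieties over `ℂ`
of CM-type whose reflex field is contained in `k` onto the `Γ`-orbits of CM-types on `k`.
-- TODO(general form): `K ⊂ ℂ` a CM-subfield not Galois over `ℚ` (as printed; Milne CM Ex. 1.35) — the tree's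
-- level-`k` carrier `GalCMType k` is for Galois `k`.
[cite: Milne1999, §2 Prop. 2.3 (p. 55)] -/
theorem milne1999_prop_2_3 : Function.Bijective (psiOrbitLevelClass k) :=
  ⟨psiOrbitLevelClass_injective k, psiOrbitLevelClass_surjective k⟩

/-- **PROPOSITION 2.3 packaged**: the natural one-to-one correspondence
`{simple complex CM abelian varieties with reflex field ⊆ k}/isogeny ≃ {CM-types on k}/Gal(k/ℚ)`.
[cite: Milne1999, §2 Prop. 2.3 (p. 55)] -/
def isogenyClassesEquivGalOrbits :
    Quotient (isogenySetoid k) ≃ MulAction.orbitRel.Quotient (k ≃ₐ[ℚ] k) (GalCMType k) :=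
  Equiv.ofBijective (psiOrbitLevelClass k) (milne1999_prop_2_3 k)

/-- **Anti-vacuity at level `k`**: there are simple complex abelian varieties of CM-type with reflex field in `k`, for
every finite Galois CM level `k` (realise any `Γ`-orbit of CM-types on `k`, `nonempty_galCMType`).
[cite: Milne1999, §2 Prop. 2.3 (p. 55)] -/
instance nonempty : Nonempty (WithReflexFieldLE k) := by
  obtain ⟨a, -⟩ := psiOrbitLevelClass_surjective k
    (Classical.arbitrary (MulAction.orbitRel.Quotient (k ≃ₐ[ℚ] k) (GalCMType k)))
  induction a using Quotient.inductionOn with | h A => ?_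
  exact ⟨A⟩

/-- [cite: Milne1999, §2 Prop. 2.3 (p. 55)] -/
instance nonempty_quotient : Nonempty (Quotient (isogenySetoid k)) :=
  ⟨Quotient.mk _ (Classical.arbitrary (WithReflexFieldLE k))⟩

/-- Compatibility with the `ℚ^{cm}`-level correspondence: extending the level-`k` orbit of `[A]` gives `{ψ_τ}(A)`.
[cite: Milne1999, §2 Prop. 2.3 proof (p. 55)] -/
theorem extendOrbit_isogenyClassesEquivGalOrbits (A : WithReflexFieldLE k) :
    extendOrbit k (isogenyClassesEquivGalOrbits k (Quotient.mk (isogenySetoid k) A)) =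
      SimpleCMAbelianVariety.isogenyClassesEquivGalOrbits (Quotient.mk SimpleCMAbelianVariety.isogenySetoid A.1) :=
  extendOrbit_psiOrbitLevel k A

end WithReflexFieldLE

end SimpleCMAbelianVariety

end Literature.AlgebraicGeometry.ComplexMultiplication

end
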